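import Literature.Analysis.FluidPDE.SereginSverakInteriorContinuity
import Literature.Analysis.FluidPDE.NSBoundedInteriorRegularityProofs
import Literature.Analysis.FluidPDE.SereginSverakBlowupCompactnessProofs
import HarnessLib

/-!
# Seregin–Šverák 2009, §4 ¶1: `InteriorContinuity` discharged

G. Seregin, V. Šverák, *On Type I singularities of the local axi-symmetric solutions of the
Navier–Stokes equations*, Comm. PDE 34 (2009), 171–201 = arXiv:0804.1803 (page references to the
arXiv version). `SereginSverak2009.InteriorContinuity` (`SereginSverakBlowup.lean`) transcribes,
in interior form, the sentence of §4 ¶1 (p. 11) "We may also assume that the function `v` is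
Hölder continuous in the completion of the set `𝒞 × ]-1,-a²[` for any `0 < a < 1`": a
distributional solution `(u, p)` in `Q = 𝒞 × ]-1, 0[` with `u ∈ L³(Q)`, `p ∈ L^{3/2}(Q)` and
(r2) (`u` essentially bounded on each `𝒞 × ]-1,-a²[`) agrees a.e. on `Q` with a function
continuous on the open cylinder `Q`.

`SereginSverakInteriorContinuity.lean` PROVES this fact from the interior continuity of
essentially bounded distributional solutions, the named fact `NSBoundedInteriorContinuity`
(`NSBoundedInteriorRegularity.lean`; §2, p. 8 of the paper: regularity inside the region of
essential boundedness, [ESS4], [LS], [NRS]), as `interiorContinuity_of`; and that fact is by now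
the theorem `NSBoundedInteriorContinuity_holds` (`NSBoundedInteriorRegularityProofs.lean`: local
caloric duality representation and du Bois-Reymond's lemma). This file composes the two
(`InteriorContinuity_holds`) and records the consequence for the blow-up step of §4: the Type I
blow-up alternative `BlowupAlternativeTypeI` (third hypothesis of the assembly
`Literature.Barriers.NavierStokesRegularity.axisymmetricTypeIExclusion_of_leaves` of the barrier
`AxisymmetricTypeIExclusion` = Thm. 3.1) now follows from the compactness step
`BlowupCompactness` alone (`blowupAlternativeTypeI_of_facts`, `SereginSverakBlowupProofs.lean`),
hence from the local Hölder bound `LocalHolderBound` alone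
(`blowupCompactness_of_localHolderBound`, `SereginSverakBlowupCompactnessProofs.lean`), i.e. from
the three catalogued estimates of the local theory of the Stokes system behind it
(`localHolderBound_of`, `SereginSverakLocalHolderProofs.lean`: `HeatDivSourceGradientBound`,
`StokesLocalIntegrabilityGain`, `StokesLocalHolderBound` of `SereginLocalStokesRegularity.lean`).

Not here: those three estimates ([LSU], [S8]); KNSS 2009, Thm. 5.3.

## References

* G. Seregin, V. Šverák, Comm. PDE 34 (2009), 171–201, arXiv:0804.1803: §4 ¶1 and (p5)–(p12)
  (p. 11), §2 (p. 8), App. II (a21)–(a22) (p. 14). [`SereginSverak2009`]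
-/

noncomputable section

namespace Literature.Analysis.FluidPDE

namespace SereginSverak2009

/-- **Seregin–Šverák 2009, §4 ¶1, discharged** ("We may also assume that the function `v` is
Hölder continuous in the completion of the set `𝒞 × ]-1,-a²[` for any `0 < a < 1`", interior
form = the named fact `InteriorContinuity`): a distributional Navier–Stokes solution in
`Q = 𝒞 × ]-1, 0[` with `u ∈ L³(Q)`, `p ∈ L^{3/2}(Q)` and (r2) has a representative continuous on
the open cylinder `Q`. From `NSBoundedInteriorContinuity_holds` through `interiorContinuity_of`.
[cite: SereginSverak2009, §4 ¶1 (arXiv p. 11) with §2 p. 8] -/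
theorem InteriorContinuity_holds : InteriorContinuity :=
  interiorContinuity_of NSBoundedInteriorContinuity_holds

/-- **The Type I blow-up alternative of §4 from the compactness step alone**: with
`InteriorContinuity_holds`, `BlowupAlternativeTypeI` (Seregin–Šverák 2009, §4 for Thm. 3.1)
follows from `BlowupCompactness` ((p5)–(p11)) by `blowupAlternativeTypeI_of_facts`.
[cite: SereginSverak2009, §4 (proof of Thm. 3.1, (p1)–(p11), arXiv p. 11)] -/
theorem blowupAlternativeTypeI_of_blowupCompactness (hBC : BlowupCompactness) :
    BlowupAlternativeTypeI :=
  blowupAlternativeTypeI_of_facts InteriorContinuity_holds hBC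

/-- **The Type I blow-up alternative of §4 from the local Hölder bound alone**: with
`InteriorContinuity_holds`, `BlowupAlternativeTypeI` follows from `LocalHolderBound` (the
uniform parabolic Hölder bound of (p12)ff) by `blowupAlternativeTypeI_of_localHolderBound`.
[cite: SereginSverak2009, §4 ((p12) and the estimates following it, arXiv p. 11)] -/
theorem blowupAlternativeTypeI_of_localHolderBound' (hLHB : LocalHolderBound) :
    BlowupAlternativeTypeI :=
  blowupAlternativeTypeI_of_localHolderBound InteriorContinuity_holds hLHB

end SereginSverak2009

end Literature.Analysis.FluidPDE
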